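import Literature.AlgebraicGeometry.HodgeTheory.NodalPencilProjectiveIsotopy
import Literature.AlgebraicGeometry.HodgeTheory.NodalPencilLocalisation
import Literature.AlgebraicGeometry.HodgeTheory.NodalPencilFoldIsotopy
import Literature.AlgebraicGeometry.HodgeTheory.NodalPencilMorseChart
import Literature.AlgebraicGeometry.HodgeTheory.NodalPencilCutoffFlows
import Literature.AlgebraicGeometry.HodgeTheory.PicardLefschetzNodalFormsKeyed
import Literature.AlgebraicGeometry.HodgeTheory.NodalFormPencilNonsingular
import Literature.AlgebraicGeometry.Motives.UniversalHypersurfaceRegularLocusChart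
import Literature.AlgebraicGeometry.Motives.UniversalHypersurfaceRegularLocusChartTarget
import Mathlib.Analysis.Calculus.BumpFunction.FiniteDimension
import Mathlib.Analysis.Calculus.ContDiff.RCLike
import Mathlib.Topology.Algebra.MvPolynomial
import HarnessLib

/-!
# The Picard–Lefschetz theorem for a one-nodal member of the universal family along a MONOMIAL pencil direction
# (`picardLefschetz_oneNode` for `g = a·xᵢ^d`)

Family `hodge`, layer `Literature/AlgebraicGeometry/HodgeTheory`. Written by the prover seat `hodge-nonav-prover-Bx` (g15, cell
`hodge-nonav`): the LEAF of the ODP-ISOTOPY port (memo `PROGRAMME-ODP-ISOTOPY-Bx-g13` §2; Picard–Lefschetz binder hPL₁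
`PicardLefschetzNodalFormsKeyed.picardLefschetz_oneNode` of crux K1-B, stmt-HodgeConjecture-19716). All constants of the classical
construction of the geometric monodromy of the pencil `f₁ + c·xᵢ^d` around its nodal member are CHOSEN here (the Morse chart of
`NodalPencilMorseChart`, radii, the node and coefficient bumps, the coefficient fields `e`, `i·e`, Lipschitz bounds, the chart of the
regular locus, the nonsingularity and disc radii), the bricks are run (`NodalPencilFoldIsotopy` → `NodalPencilMonodromyMap` →
`NodalPencilLocalisation` → `NodalPencilFibreBridge`/`NodalPencilProjectiveIsotopy`), and the socket
`PicardLefschetzOfPencilIsotopy.exists_isPicardLefschetzData_one_of_pencilIsotopy` closes: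

* `formOfCoeffs_coeffsOf_add_single`, `coeffVector_eq_of_pointForm_eq`, `eval_smul_X_pow` — bookkeeping of the pencil `f₁ + c·(a xᵢ^d)`;
* **`picardLefschetz_oneNode_monomial`** — the statement of `picardLefschetz_oneNode` VERBATIM for the direction `g := a • X i ^ d`
  (any `a`, `i` with `g(p) ≠ 0`, i.e. `a ≠ 0` and `pᵢ ≠ 0`): for `n, d ≥ 1`, a form `f₁` of degree `d` with exactly one node `[p]`,
  there is `ε₀ > 0` with (i) `f₁ + c' g` nonsingular for `0 < |c'| < ε₀` and, for every `hU`, `0 < ε < ε₀`, `s'` with form `f₁ + ε g`,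
  circle `γ` of the pencil at `s'`, and — if `n` is even — provided the rational transport along `γ` is not the identity:
  `∃ δ c, IsPicardLefschetzData n d 1 … γ ![δ] c`.

Everything is proved; no definitions, no named facts. HONEST SCOPE: this discharges the binder `picardLefschetz_oneNode` for MONOMIAL
directions only (the instances consumed by the telescope of crux K1-B are of this form up to the scalar `a`); the general-direction
statement is not proved here; nothing here says HC or any rung is proved.

## References

* [VoisinHodgeII2003] C. Voisin, Hodge Theory and Complex Algebraic Geometry II (2003), §3.2.1 Thm. 3.16, Cor. 3.17, Rem. 3.18;
  §2.3.1–§2.3.3; §6.2.1.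
* [ArnoldGuseinzadeVarchenko2012] V. I. Arnold, S. M. Gusein-Zade, A. N. Varchenko, Singularities of Differentiable Maps II (2012),
  Part I §1.1–§1.3, §2.1.
* [Milnor1968] J. Milnor, Singular Points of Complex Hypersurfaces, §9.
* [Lamotke1981] K. Lamotke, The topology of complex projective varieties after S. Lefschetz, Topology 20 (1981), §5–§6.
-/

noncomputable section

open CategoryTheory AlgebraicGeometry MvPolynomial TopologicalSpace Set Topology Filter Complex Metric
open scoped Manifold ContDiff Real unitInterval
open Literature.AlgebraicGeometry.Motives Literature.AlgebraicGeometry.Motives.UniversalHypersurface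
open Literature.AlgebraicGeometry.HodgeTheory.UniversalHypersurface Literature.Geometry.ComplexAnalytic Literature.Geometry.Manifold
open Literature.AlgebraicTopology.SingularHomology Literature.NumberTheory.Transcendental

namespace Literature.AlgebraicGeometry.HodgeTheory

namespace NodalPencil

/-! ### Bookkeeping of the pencil `f₁ + c·xᵢ^d` -/

/-- `formOfCoeffs (coeffs f₁ + c·e_{xᵢ^d}) = f₁ + c • xᵢ^d`. [cite: VoisinHodgeII2003, §6.2.1] -/
theorem formOfCoeffs_coeffsOf_add_single {n d : ℕ} (i : Fin (n + 2)) {f₁ : MvPolynomial (Fin (n + 2)) ℂ} (hf₁ : f₁.IsHomogeneous d)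
    (c : ℂ) : formOfCoeffs (coeffsOf n d f₁ + Pi.single (regPowIndex n d i) c) = f₁ + c • X i ^ d := by
  classical
  rw [formOfCoeffs_add, formOfCoeffs_coeffsOf n d hf₁, formOfCoeffs_def,
    Finset.sum_eq_single (regPowIndex n d i) (fun b _ hb => by rw [Pi.single_eq_of_ne hb, monomial_zero])
      (fun h => absurd (Finset.mem_univ _) h), Pi.single_eq_same]
  change f₁ + monomial (Finsupp.single i d) c = _
  rw [smul_eq_C_mul, X_pow_eq_monomial, C_mul_monomial, mul_one]

/-- The coefficient vector of a base point with form `f₁ + c • xᵢ^d` is `coeffs f₁ + c·e_{xᵢ^d}`. [cite: VoisinHodgeII2003, §6.2.1] -/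
theorem coeffVector_eq_of_pointForm_eq {n d : ℕ} (i : Fin (n + 2)) {f₁ : MvPolynomial (Fin (n + 2)) ℂ} (hf₁ : f₁.IsHomogeneous d)
    {s : ComplexPoints (base ℂ n d)} {c : ℂ} (hs : pointForm ℂ n d s = f₁ + c • X i ^ d) :
    coeffVector ℂ n d s = coeffsOf n d f₁ + Pi.single (regPowIndex n d i) c := by
  have h1 : formOfCoeffs (coeffVector ℂ n d s) = formOfCoeffs (coeffsOf n d f₁ + Pi.single (regPowIndex n d i) c) := by
    rw [formOfCoeffs_coeffVector, formOfCoeffs_coeffsOf_add_single i hf₁, hs]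
  have h2 := congrArg (coeffsOf n d) h1
  simpa only [coeffsOf_formOfCoeffs] using h2

/-- `(a • xᵢ^d)(p) = a pᵢ^d`. [cite: VoisinHodgeII2003, §2.3.1] -/
theorem eval_smul_X_pow {n d : ℕ} (i : Fin (n + 2)) (a : ℂ) (p : Fin (n + 2) → ℂ) :
    eval p (a • X i ^ d : MvPolynomial (Fin (n + 2)) ℂ) = a * p i ^ d := by
  simp [smul_eval]

/-! ### The theorem -/

set_option maxHeartbeats 1600000 in
/-- **Picard–Lefschetz for a one-nodal member of the universal family along a monomial pencil direction**: the statement of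
`picardLefschetz_oneNode` for `g := a • X i ^ d`. [cite: VoisinHodgeII2003, §3.2.1 Thm. 3.16 and Cor. 3.17]
[cite: ArnoldGuseinzadeVarchenko2012, Part I §1.3 and §2.1] [cite: Lamotke1981, §6] -/
theorem picardLefschetz_oneNode_monomial (n d : ℕ) (hn : 1 ≤ n) (hd : 1 ≤ d) (f₁ : MvPolynomial (Fin (n + 2)) ℂ)
    (hf₁ : f₁.IsHomogeneous d) (p : Fin (n + 2) → ℂ) (hp : IsNodalFormWithNodes f₁ ![p]) (i : Fin (n + 2)) (a : ℂ)
    (hga : eval p (a • X i ^ d : MvPolynomial (Fin (n + 2)) ℂ) ≠ 0) :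
    ∃ ε₀ : ℝ, 0 < ε₀ ∧
      (∀ c' : ℂ, c' ≠ 0 → ‖c'‖ < ε₀ → SmoothHypersurface.IsNonsingularForm ℂ (f₁ + c' • (a • X i ^ d))) ∧
      ∀ (hU : IsCohomologicallyLocallyTrivialOn (family ℂ n d) Set.univ) (ε : ℝ), 0 < ε → ε < ε₀ →
        ∀ (s' : ComplexPoints (base ℂ n d)), pointForm ℂ n d s' = f₁ + (ε : ℂ) • (a • X i ^ d) →
          ∀ (γ : Path s' s'), IsPencilCircle n d f₁ (a • X i ^ d) ε γ →
            (Even n → ∀ T : bettiCohomology (fiberOver (family ℂ n d) s') n ≃ₗ[ℚ]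
                bettiCohomology (fiberOver (family ℂ n d) s') n,
              IsRatTransport (family ℂ n d) n hU (loopClassUniv n d γ) T → T ≠ LinearEquiv.refl ℚ _) →
            ∃ (δ : bettiCohomology (fiberOver (family ℂ n d) s') n) (c : ℚ),
              IsPicardLefschetzData n d 1 hn hd hU γ ![δ] c := by
  classical
  have hd' : 0 < d := hd
  -- `a ≠ 0`, `pᵢ ≠ 0`
  rw [eval_smul_X_pow] at hga
  have ha : a ≠ 0 := left_ne_zero_of_mul hga
  have hpi : p i ≠ 0 := fun h => hga (by rw [h, zero_pow (by omega), mul_zero])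
  have hODP : IsOrdinaryDoublePointOf f₁ p := hp.1 0
  set b₀ : DegIndex n d → ℂ := coeffsOf n d f₁ with hb₀
  set m₀ : DegIndex n d := regPowIndex n d i with hm₀
  set y₀ : Fin (n + 1) → ℂ := fun j => p (i.succAbove j) / p i with hy₀
  haveI : T2Space (ComplexPoints (regularTotal ℂ n d)) := t2Space_regularTotal n d
  ------------------------------------------------------------------
  -- (1) the Morse chart and the pencil coordinate `φ`
  ------------------------------------------------------------------
  obtain ⟨Θ, hy₀s, hΘ0, hΘ, hΘs, hΘc, hΘφ'⟩ := exists_pencil_morseChart_coeff (n := n) hf₁ hd hODP hpi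
  set φ : (Fin (n + 1) → ℂ) → ℂ := fun y => -MvPolynomial.eval (Fin.insertNth i (1 : ℂ) y : Fin (n + 2) → ℂ) f₁ with hφ_def
  have hφ : ∀ y, φ y = regChartCoeffVec n d i
      (Sum.elim (fun m : {m : DegIndex n d // m ≠ regPowIndex n d i} => b₀ m.1) y) (regPowIndex n d i) - b₀ (regPowIndex n d i) := by
    intro y
    rw [hb₀, regChartCoeffVec_pencil_regPowIndex_of_isHomogeneous n d i hf₁, coeffsOf_apply]
    change -_ = MvPolynomial.coeff (Finsupp.single i d) f₁ - _ - MvPolynomial.coeff (Finsupp.single i d) f₁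
    ring
  have hΘφ : ∀ y ∈ Θ.source, ∑ j, (Θ y j) ^ 2 = φ y := fun y hy => by rw [hφ y]; exact hΘφ' y hy
  have hφc : Continuous φ :=
    ((MvPolynomial.continuous_eval f₁).comp
      (Continuous.finInsertNth (A := fun _ : Fin (n + 2) => ℂ) i continuous_const continuous_id)).neg
  ------------------------------------------------------------------
  -- (2) the radii
  ------------------------------------------------------------------
  obtain ⟨ρ, hρ, hρt⟩ := Metric.isOpen_iff.mp Θ.open_target 0 (by rw [← hΘ0]; exact Θ.map_source hy₀s)
  set r : ℝ := ρ / 2 with hr_def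
  have hr0 : 0 < r := by positivity
  have hrt : {z : Fin (n + 1) → ℂ | ∑ j, ‖z j‖ ^ 2 ≤ r ^ 2} ⊆ Θ.target := by
    intro z hz
    refine hρt (mem_ball_zero_iff.mpr ((pi_norm_lt_iff hρ).mpr fun j => ?_))
    have hj : ‖z j‖ ^ 2 ≤ r ^ 2 :=
      le_trans (Finset.single_le_sum (fun j _ => sq_nonneg ‖z j‖) (Finset.mem_univ j)) hz
    have : ‖z j‖ ≤ r := le_of_sq_le_sq hj hr0.le
    linarith
  set R'' : ℝ := r ^ 2 with hR''_def
  have hR''t : {z : Fin (n + 1) → ℂ | ∑ j, ‖z j‖ ^ 2 ≤ R''} ⊆ Θ.target := hrt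
  set R''' : ℝ := r ^ 2 / 2 with hR'''_def
  have hR : R''' < R'' := by rw [hR'''_def, hR''_def]; nlinarith
  have hR'''0 : 0 < R''' := by positivity
  set r₂ : ℝ := min (1 / 2) (R''' / 2) with hr₂_def
  have hr₂0 : 0 < r₂ := by positivity
  have hr₂h : r₂ ≤ 1 / 2 := min_le_left _ _
  have hr₂R : r₂ ≤ R''' / 2 := min_le_right _ _
  have hr₂sq : r₂ ^ 2 < R''' := by nlinarith
  set s₁ : ℝ := r₂ / 2 with hs₁_def
  set s₀ : ℝ := r₂ / 4 with hs₀_def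
  have hs₀ : 0 < s₀ := by positivity
  have hs₀₁ : s₀ ^ 2 < s₁ ^ 2 := by rw [hs₀_def, hs₁_def]; nlinarith
  have hs₁r : s₁ ^ 2 < r₂ ^ 2 := by rw [hs₁_def]; nlinarith
  set T : ℝ := r₂ ^ 2 with hT_def
  set T' : ℝ := r₂ ^ 2 / 2 with hT'_def
  set t₁ : ℝ := s₁ ^ 2 with ht₁_def
  set t₂ : ℝ := 3 * r₂ ^ 2 / 8 with ht₂_def
  have hT0 : 0 < T := by positivity
  have hT'0 : 0 < T' := by positivity
  have hTR : T ≤ R''' := hr₂sq.le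
  have hTr : T ≤ r ^ 2 := by rw [hT_def]; linarith
  have hTr₂ : T ≤ r₂ ^ 2 := le_rfl
  have ht₁ : s₁ ^ 2 ≤ t₁ := le_rfl
  have ht₁₂ : t₁ < t₂ := by rw [ht₁_def, ht₂_def, hs₁_def]; nlinarith
  have ht₂T' : t₂ < T' := by rw [ht₂_def, hT'_def]; nlinarith
  have hT'T : T' < T := by rw [hT'_def, hT_def]; nlinarith
  set δ : ℝ := s₀ ^ 2 / 2 with hδ_def
  have hδ0 : 0 < δ := by positivity
  have hδ : δ < s₀ ^ 2 := by rw [hδ_def]; linarith [pow_pos hs₀ 2]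
  ------------------------------------------------------------------
  -- (3) the node cut-off `β` (centred at `y₀`)
  ------------------------------------------------------------------
  have hUo : IsOpen (Θ.source ∩ {x | ∑ j, ‖Θ x j‖ ^ 2 < s₀ ^ 2}) := PhamBrieskorn.isOpen_chartBall Θ
  have hy₀U : y₀ ∈ Θ.source ∩ {x | ∑ j, ‖Θ x j‖ ^ 2 < s₀ ^ 2} :=
    ⟨hy₀s, by rw [mem_setOf_eq, hΘ0]; simp [pow_pos hs₀ 2]⟩
  obtain ⟨η₀, hη₀, hη₀U⟩ := Metric.isOpen_iff.mp hUo y₀ hy₀U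
  set η : ℝ := η₀ / 3 with hη_def
  have hη : 0 < η := by positivity
  let β : ContDiffBump y₀ := ⟨η, 2 * η, hη, by linarith⟩
  have hβ : ContDiff ℝ ∞ β := β.contDiff
  have hβR : ∀ y : Fin (n + 1) → ℂ, 2 * η + ‖y₀‖ < ‖y‖ → β y = 0 := fun y hy =>
    β.zero_of_le_dist (by
      rw [dist_eq_norm]
      have := norm_sub_norm_le y y₀
      linarith)
  have hβ1 : ∀ y : Fin (n + 1) → ℂ, ‖y - y₀‖ < η → β y = 1 := fun y hy =>
    β.one_of_mem_closedBall (by rw [mem_closedBall, dist_eq_norm]; exact hy.le)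
  have hβs : ∀ y : Fin (n + 1) → ℂ, β y ≠ 0 → y ∈ Θ.source ∧ ∑ j, ‖Θ y j‖ ^ 2 < s₀ ^ 2 := by
    intro y hy
    have hmem : y ∈ Function.support (β : (Fin (n + 1) → ℂ) → ℝ) := hy
    rw [β.support_eq] at hmem
    have hyball : y ∈ ball y₀ η₀ := by
      rw [mem_ball] at hmem ⊢
      change dist y y₀ < 2 * η at hmem
      linarith
    exact hη₀U hyball
  ------------------------------------------------------------------
  -- (4) the base cut-off `χ'`, the nonsingularity radius, the base fields
  ------------------------------------------------------------------
  obtain ⟨V, hVo, hb₀V, hV⟩ := exists_coeff_nhds_singular_subset_nodeNbhd n d i y₀ η hη hf₁ hp hpi rfl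
  obtain ⟨ρV, hρV, hρVV⟩ := Metric.isOpen_iff.mp hVo b₀ hb₀V
  set ρK : ℝ := min (ρV / 2) δ with hρK_def
  have hρK0 : 0 < ρK := by positivity
  have hρδ : ρK ≤ δ := min_le_right _ _
  set K : Set (DegIndex n d → ℂ) := closedBall b₀ ρK with hK_def
  have hK : IsCompact K := isCompact_closedBall _ _
  have hKV : K ⊆ V := (closedBall_subset_ball (by
    rw [hρK_def]; exact lt_of_le_of_lt (min_le_left _ _) (by linarith))).trans hρVV
  let χ : ContDiffBump b₀ := ⟨ρK / 2, ρK, by positivity, by linarith⟩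
  have hχ : ContDiff ℝ ∞ χ := χ.contDiff
  have hχK0 : ∀ b, b ∉ K → χ b = 0 := fun b hb =>
    χ.zero_of_le_dist (by rw [hK_def, mem_closedBall] at hb; exact (not_le.mp hb).le)
  have hχK : ∀ b, χ b ≠ 0 → ‖b - b₀‖ < ρK := by
    intro b hb
    have hmem : b ∈ Function.support (χ : (DegIndex n d → ℂ) → ℝ) := hb
    rw [χ.support_eq, mem_ball, dist_eq_norm] at hmem
    exact hmem
  -- nonsingularity of `f₁ + c'·(a xᵢ^d)` for `0 < |c'| < ε₁`
  have hg : (a • X i ^ d : MvPolynomial (Fin (n + 2)) ℂ).IsHomogeneous d := by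
    rw [smul_eq_C_mul]
    simpa using ((isHomogeneous_C (Fin (n + 2)) a).mul (isHomogeneous_X_pow (R := ℂ) i d))
  have hgp : ∀ j : Fin 1, eval ((![p] : Fin 1 → Fin (n + 2) → ℂ) j) (a • X i ^ d : MvPolynomial (Fin (n + 2)) ℂ) ≠ 0 := by
    intro j
    have hj : j = 0 := Subsingleton.elim _ _
    subst hj
    change eval p _ ≠ 0
    rw [eval_smul_X_pow]; exact hga
  obtain ⟨ε₁, hε₁, hns₁⟩ := hp.exists_isNonsingularForm_add_smul hd hf₁ hg hgp
  -- in terms of the coefficient `c = c' a` of `xᵢ^d`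
  have hns₂ : ∀ c : ℂ, c ≠ 0 → ‖c‖ < ε₁ * ‖a‖ →
      SmoothHypersurface.IsNonsingularForm ℂ (formOfCoeffs (b₀ + Pi.single m₀ c)) := by
    intro c hc0 hc
    rw [hb₀, hm₀, formOfCoeffs_coeffsOf_add_single i hf₁]
    have heq : f₁ + c • X i ^ d = f₁ + (c / a) • (a • X i ^ d : MvPolynomial (Fin (n + 2)) ℂ) := by
      rw [smul_smul, div_mul_cancel₀ c ha]
    rw [heq]
    refine hns₁ (c / a) (div_ne_zero hc0 ha) ?_
    rw [norm_div, div_lt_iff₀ (norm_pos_iff.mpr ha)]; exact hc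
  set ρW : ℝ := min (ρK / 2) (ε₁ * ‖a‖) with hρW_def
  have hρW : 0 < ρW := lt_min (by positivity) (mul_pos hε₁ (norm_pos_iff.mpr ha))
  have hχ1 : ∀ b, ‖b - b₀‖ < ρW → χ b = 1 := fun b hb =>
    χ.one_of_mem_closedBall (by
      rw [mem_closedBall, dist_eq_norm]
      exact (hb.trans_le (min_le_left _ _)).le)
  have hns : ∀ c : ℂ, c ≠ 0 → ‖c‖ < ρW →
      SmoothHypersurface.IsNonsingularForm ℂ (formOfCoeffs (b₀ + Pi.single m₀ c)) :=
    fun c hc0 hc => hns₂ c hc0 (hc.trans_le (min_le_right _ _))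
  let W₁ : (DegIndex n d → ℂ) → (DegIndex n d → ℂ) := fun _ => Pi.single m₀ 1
  let W₂ : (DegIndex n d → ℂ) → (DegIndex n d → ℂ) := fun _ => Pi.single m₀ Complex.I
  have hW₁ : ContDiff ℝ ∞ W₁ := contDiff_const
  have hW₂ : ContDiff ℝ ∞ W₂ := contDiff_const
  have hW₁' : ∀ b (m : DegIndex n d), m ≠ m₀ → W₁ b m = 0 := fun b m hm => Pi.single_eq_of_ne hm _
  have hW₂' : ∀ b (m : DegIndex n d), m ≠ m₀ → W₂ b m = 0 := fun b m hm => Pi.single_eq_of_ne hm _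
  have hW₁u : ∀ b, ‖b - b₀‖ < ρW → W₁ b m₀ = 1 := fun b _ => Pi.single_eq_same _ _
  have hW₂u : ∀ b, ‖b - b₀‖ < ρW → W₂ b m₀ = Complex.I := fun b _ => Pi.single_eq_same _ _
  -- Lipschitz bounds for `v_w(z) = χ(b₀ + z e_{m₀}) · w`
  obtain ⟨Cχ, hCχ⟩ := ContDiff.lipschitzWith_of_hasCompactSupport (𝕂 := ℝ) (n := 1) χ.hasCompactSupport χ.contDiff one_ne_zero
  have hA : LipschitzWith ‖(ContinuousLinearMap.single ℝ (fun _ : DegIndex n d => ℂ) m₀ : ℂ →L[ℝ] (DegIndex n d → ℂ))‖₊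
      (fun z : ℂ => b₀ + Pi.single m₀ z) := by
    have h := (ContinuousLinearMap.single ℝ (fun _ : DegIndex n d => ℂ) m₀).lipschitz
    have h2 := (LipschitzWith.const (α := ℂ) b₀).add h
    simpa using h2
  have hLw : ∀ w : ℂ, LipschitzWith ‖((ContinuousLinearMap.id ℝ ℝ).smulRight w : ℝ →L[ℝ] ℂ)‖₊ fun x : ℝ => x • w := fun w =>
    ((ContinuousLinearMap.id ℝ ℝ).smulRight w).lipschitz
  have hv : ∀ w : ℂ, ∃ Kw : NNReal, LipschitzWith Kw (fun z : ℂ => (χ (b₀ + Pi.single m₀ z)) • w) := fun w =>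
    ⟨_, ((hLw w).comp hCχ).comp hA⟩
  obtain ⟨K₁, hK₁⟩ := hv 1
  obtain ⟨K₂, hK₂⟩ := hv Complex.I
  have hv₁ : LipschitzWith K₁ (fun z : ℂ => (χ (b₀ + Pi.single m₀ z) : ℂ) * W₁ (b₀ + Pi.single m₀ z) m₀) := by
    have heq : (fun z : ℂ => (χ (b₀ + Pi.single m₀ z) : ℂ) * W₁ (b₀ + Pi.single m₀ z) m₀) =
        fun z : ℂ => (χ (b₀ + Pi.single m₀ z)) • (1 : ℂ) := by
      funext z; simp [W₁, Complex.real_smul]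
    rw [heq]; exact hK₁
  have hv₂ : LipschitzWith K₂ (fun z : ℂ => (χ (b₀ + Pi.single m₀ z) : ℂ) * W₂ (b₀ + Pi.single m₀ z) m₀) := by
    have heq : (fun z : ℂ => (χ (b₀ + Pi.single m₀ z) : ℂ) * W₂ (b₀ + Pi.single m₀ z) m₀) =
        fun z : ℂ => (χ (b₀ + Pi.single m₀ z)) • Complex.I := by
      funext z; simp [W₂, Complex.real_smul]
    rw [heq]; exact hK₂
  ------------------------------------------------------------------
  -- (5) the fold isotopy
  ------------------------------------------------------------------
  obtain ⟨gF, hgc, hg0, hg2π, hgO, hgadd, hgS, hgF⟩ := exists_pencil_foldIsotopy_invariant hd' b₀ hΘ hΘs hΘc φ hφc hφ hs₀ hs₀₁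
    hs₁r hr₂sq hR hR''t hδ y₀ β hβ hβR hβ1 hβs χ hχ hK hKV hχK0 hV hχK hρδ hχ1 W₁ W₂ hW₁ hW₂ hW₁' hW₂' hW₁u hW₂u hv₁ hv₂
  ------------------------------------------------------------------
  -- (6) the chart of the regular locus
  ------------------------------------------------------------------
  have hne : (regChartDom n d i).Nonempty := by
    -- the point `y = Θ⁻¹(t, 0, …, 0)` of the member `c = t²`, `t` small real
    set t : ℝ := min (r / 2) (Real.sqrt ρW / 2) with ht_def
    have ht0 : 0 < t := by positivity
    have htr : t ≤ r / 2 := min_le_left _ _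
    have htρ : t ≤ Real.sqrt ρW / 2 := min_le_right _ _
    let z : Fin (n + 1) → ℂ := Pi.single (0 : Fin (n + 1)) (t : ℂ)
    have hzsum : ∑ j, ‖z j‖ ^ 2 = t ^ 2 := by
      rw [Finset.sum_eq_single (0 : Fin (n + 1)) (fun b _ hb => by simp [z, Pi.single_eq_of_ne hb]) (by simp)]
      simp [z, abs_of_pos ht0]
    have hzsq : ∑ j, (z j) ^ 2 = ((t ^ 2 : ℝ) : ℂ) := by
      rw [Finset.sum_eq_single (0 : Fin (n + 1)) (fun b _ hb => by simp [z, Pi.single_eq_of_ne hb]) (by simp)]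
      simp [z]
    have hzt : z ∈ Θ.target := hrt (by change ∑ j, ‖z j‖ ^ 2 ≤ r ^ 2; rw [hzsum]; nlinarith)
    set y := Θ.symm z with hy
    have hys : y ∈ Θ.source := Θ.map_target hzt
    have hφy : φ y = ((t ^ 2 : ℝ) : ℂ) := by rw [← hΘφ y hys, hy, Θ.right_inv hzt, hzsq]
    have hc0 : (((t ^ 2 : ℝ)) : ℂ) ≠ 0 := by exact_mod_cast (by positivity : t ^ 2 ≠ 0)
    have hcρ : ‖((t ^ 2 : ℝ) : ℂ)‖ < ρW := by
      rw [Complex.norm_real, Real.norm_eq_abs, abs_of_pos (by positivity)]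
      have h1 : t ^ 2 ≤ ρW / 4 := by
        have := Real.sq_sqrt hρW.le
        nlinarith [Real.sqrt_nonneg ρW]
      linarith
    have hvns : SmoothHypersurface.IsNonsingularForm ℂ (formOfCoeffs (regChartCoeffVec n d i
        (Sum.elim (fun m : {m : DegIndex n d // m ≠ regPowIndex n d i} => b₀ m.1) y))) := by
      rw [regChartCoeffVec_slice_eq b₀ φ hφ, hφy]
      exact hns _ hc0 hcρ
    obtain ⟨Q, hQ, -⟩ := exists_regChartFun_eq_of_nonsingular n d i hd' _ hvns
    exact ⟨Q, hQ⟩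
  obtain ⟨Φ, hΦ, hΦs, hΦt, -, -⟩ := exists_regChart (n := n) (d := d) (i := i) hd' hne
  ------------------------------------------------------------------
  -- (7) the disc radius and the monodromy map
  ------------------------------------------------------------------
  set δ₀ : ℝ := min (ρW / 4) (T' / (2 * (n + 1))) with hδ₀_def
  have hδ₀0 : 0 < δ₀ := by positivity
  have hδ₀W : δ₀ ≤ ρW / 4 := min_le_left _ _
  have hδ₀T : δ₀ ≤ T' / (2 * (n + 1)) := min_le_right _ _
  have hδρ : δ₀ ≤ ρW := by linarith
  obtain ⟨h, k, H, hhc, hh0, hhk, hh1, hHc, hH⟩ := exists_pencil_monodromyMap hd' b₀ Φ hΦ hΦs hΦt Θ hrt φ hφ hΘφ hρW hns hR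
    hTR hTr hT0 gF hgc hg0 hg2π hgO hgadd hgS hgF hs₀₁ hTr₂ hδ₀W hΘ hR''t ht₁ ht₁₂ ht₂T'.le hT'T
  ------------------------------------------------------------------
  -- (8) `ε₀` and the data of a member
  ------------------------------------------------------------------
  refine ⟨min ε₁ (δ₀ / ‖a‖), lt_min hε₁ (div_pos hδ₀0 (norm_pos_iff.mpr ha)), fun c' hc' hc'ε =>
    hns₁ c' hc' (hc'ε.trans_le (min_le_left _ _)), ?_⟩
  intro hU ε hε hεε₀ s' hs' γ hγ hT1
  -- the coefficient `c = ε a` of `xᵢ^d`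
  set c : ℂ := (ε : ℂ) * a with hc_def
  have hc0 : c ≠ 0 := mul_ne_zero (by exact_mod_cast hε.ne') ha
  have hcδ : ‖c‖ < δ₀ := by
    rw [hc_def, norm_mul, Complex.norm_real, Real.norm_eq_abs, abs_of_pos hε]
    have h1 : ε < δ₀ / ‖a‖ := hεε₀.trans_le (min_le_right _ _)
    rwa [lt_div_iff₀ (norm_pos_iff.mpr ha)] at h1
  have hcρ : ‖c‖ < ρW := hcδ.trans_le hδρ
  have hs : coeffVector ℂ n d s' = b₀ + Pi.single m₀ c := by
    refine coeffVector_eq_of_pointForm_eq i hf₁ ?_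
    rw [hs', smul_smul]
  have hγ' : ∀ u : I, coeffVector ℂ n d (γ u) =
      b₀ + Pi.single m₀ (Complex.exp (((2 * π * (u : ℝ) : ℝ) : ℂ) * Complex.I) * c) := by
    intro u
    refine coeffVector_eq_of_pointForm_eq i hf₁ ?_
    rw [hγ u, smul_smul]
    congr 2
    rw [hc_def]; push_cast; ring_nf
  -- the member is compact
  have hXc : IsCompact (pencilFibre n d i b₀ c) := isCompact_pencilFibre_of_coeffVector_eq i b₀ hn hd hs
  -- the rescaling roots `λⱼ² = c` with `Σ|λⱼ|² < T'`
  obtain ⟨zc, hzc⟩ := IsAlgClosed.exists_pow_nat_eq c two_pos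
  let lam : Fin (n + 1) → ℂ := fun _ => zc
  have hlam : ∀ j, lam j ^ 2 = c := fun _ => hzc
  have hlamT : ∑ j, ‖lam j‖ ^ 2 < T' := by
    simp only [lam, Finset.sum_const, Finset.card_univ, Fintype.card_fin, nsmul_eq_mul]
    rw [← norm_pow, hzc]
    have h1 : ‖c‖ < T' / (2 * (n + 1)) := hcδ.trans_le hδ₀T
    have hn1 : (0 : ℝ) < n + 1 := by positivity
    rw [lt_div_iff₀ (by positivity)] at h1
    push_cast
    nlinarith
  ------------------------------------------------------------------
  -- (9) the localisation datum on the member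
  ------------------------------------------------------------------
  have h2π : Complex.exp (((2 * π * (1 : ℝ) : ℝ) : ℂ) * Complex.I) = 1 := by
    rw [mul_one, show (((2 * π : ℝ)) : ℂ) * Complex.I = 2 * π * Complex.I by push_cast; ring]
    exact Complex.exp_two_pi_mul_I
  have h2π' : Complex.exp (((-(2 * π * (1 : ℝ)) : ℝ) : ℂ) * Complex.I) = 1 := by
    rw [mul_one, show (((-(2 * π) : ℝ)) : ℂ) * Complex.I = -(2 * π * Complex.I) by push_cast; ring, Complex.exp_neg,
      Complex.exp_two_pi_mul_I, inv_one]
  have hh₁c : Continuous fun x : {x : pencilSlice n d i b₀ // pencilCoord n d i b₀ x.1 ≠ 0} => h (1, x.1) :=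
    hhc.comp (continuous_const.prodMk continuous_id)
  have hh₁pc : ∀ x : pencilSlice n d i b₀, pencilCoord n d i b₀ x.1 ≠ 0 → ‖pencilCoord n d i b₀ x.1‖ < δ₀ →
      pencilCoord n d i b₀ (h (1, x)).1 = pencilCoord n d i b₀ x.1 := fun x hx0 hxδ => by
    rw [(hhk 1 x hx0 hxδ).1, h2π, one_mul]
  have hh₁F : ∀ x : pencilSlice n d i b₀, pencilCoord n d i b₀ x.1 ≠ 0 → ‖pencilCoord n d i b₀ x.1‖ < δ₀ →
      satRadius n d i Θ R''' R'' x.1 < T → satRadius n d i Θ R''' R'' (h (1, x)).1 = satRadius n d i Θ R''' R'' x.1 :=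
    fun x hx0 hxδ hF => (hhk 1 x hx0 hxδ).2.1 hF
  have hh₁id : ∀ x : pencilSlice n d i b₀, pencilCoord n d i b₀ x.1 ≠ 0 → ‖pencilCoord n d i b₀ x.1‖ < δ₀ →
      t₂ ≤ satRadius n d i Θ R''' R'' x.1 → h (1, x) = x := fun x hx0 hxδ hF => hh1 x hx0 hxδ hF
  have hk₁h₁ : ∀ x : pencilSlice n d i b₀, pencilCoord n d i b₀ x.1 ≠ 0 → ‖pencilCoord n d i b₀ x.1‖ < δ₀ →
      k (1, h (1, x)) = x := fun x hx0 hxδ => (hhk 1 x hx0 hxδ).2.2.2.1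
  have hh₁k₁ : ∀ x : pencilSlice n d i b₀, pencilCoord n d i b₀ x.1 ≠ 0 → ‖pencilCoord n d i b₀ x.1‖ < δ₀ →
      h (1, k (1, x)) = x := fun x hx0 hxδ => (hhk 1 x hx0 hxδ).2.2.2.2.1
  have hk₁pc : ∀ x : pencilSlice n d i b₀, pencilCoord n d i b₀ x.1 ≠ 0 → ‖pencilCoord n d i b₀ x.1‖ < δ₀ →
      pencilCoord n d i b₀ (k (1, x)).1 = pencilCoord n d i b₀ x.1 := fun x hx0 hxδ => by
    rw [(hhk 1 x hx0 hxδ).2.2.2.2.2.1, h2π', one_mul]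
  have hH' : ∀ (s : ℝ) (x : pencilSlice n d i b₀), pencilCoord n d i b₀ x.1 ≠ 0 → ‖pencilCoord n d i b₀ x.1‖ < δ₀ →
      satRadius n d i Θ R''' R'' x.1 < T →
      pencilCoord n d i b₀ (H (s, x)).1 = pencilCoord n d i b₀ x.1 ∧
      satRadius n d i Θ R''' R'' (H (s, x)).1 = satRadius n d i Θ R''' R'' x.1 ∧
      (H (0, x)).1 = chartModelIsotopy (fun _ : Fin (n + 1) => 2) Φ Θ (2 * π) x.1 ∧
      (satRadius n d i Θ R''' R'' x.1 ≤ T' → H (1, x) = (fun x => h (1, x)) x) := fun s x hx0 hxδ hF => hH s x hx0 hxδ hF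
  obtain ⟨κ, κA, e, g, hκ, hκB, hκA, hinj, hg', hconj⟩ := exists_localisation_pencilFibre hd' b₀ Φ hΦ hΦs hΦt Θ hrt hΘ hR''t
    φ hφ hΘφ hns hR hTR hTr ht₂T' hT'T hδρ (fun x => h (1, x)) (fun x => k (1, x)) hh₁c hh₁pc hh₁F hh₁id hk₁h₁ hh₁k₁ hk₁pc
    H hHc hH' hc0 hcδ hXc lam hlam hlamT
  -- the open cover of the member
  have hFc : Continuous (satRadius n d i Θ R''' R'') := continuous_satRadius n d i Θ R''' R'' hd' hΘ hR hR''t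
  have hAo : IsOpen {Q : ↥(pencilFibre n d i b₀ c) | satRadius n d i Θ R''' R'' Q.1 < T'} :=
    isOpen_lt (hFc.comp continuous_subtype_val) continuous_const
  have hBo : IsOpen {Q : ↥(pencilFibre n d i b₀ c) | t₂ < satRadius n d i Θ R''' R'' Q.1} :=
    isOpen_lt continuous_const (hFc.comp continuous_subtype_val)
  have hAB : {Q : ↥(pencilFibre n d i b₀ c) | satRadius n d i Θ R''' R'' Q.1 < T'} ∪
      {Q : ↥(pencilFibre n d i b₀ c) | t₂ < satRadius n d i Θ R''' R'' Q.1} = univ := eq_univ_of_forall fun y => by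
    by_cases hy : satRadius n d i Θ R''' R'' y.1 < T'
    · exact Or.inl hy
    · exact Or.inr (lt_of_lt_of_le ht₂T' (not_lt.mp hy))
  ------------------------------------------------------------------
  -- (10) the socket
  ------------------------------------------------------------------
  exact exists_isPicardLefschetzData_one_of_pencilMonodromy hn hd b₀ hU h k hhc hh0
    (fun u x hx0 hxδ => by
      obtain ⟨hpc, -, -, hkh, hhk', hpk, -⟩ := hhk u x hx0 hxδ
      exact ⟨hpc, hkh, hhk', hpk⟩)
    hc0 hcδ hs γ hγ' hAo hBo hAB κ hκ (fun y hy => hκB y hy) κA hκA e (hinj n) g hg' hconj hT1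

end NodalPencil

end Literature.AlgebraicGeometry.HodgeTheory

end
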